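import Mathlib.Analysis.SpecialFunctions.ExpDeriv
import Mathlib.Analysis.SpecialFunctions.Log.Deriv
import Mathlib.Analysis.SpecialFunctions.Sqrt
import Mathlib.Analysis.Complex.RealDeriv
import HarnessLib

/-!
# Lagarias 2009: the Schrödinger operator with Morse potential — the Whittaker substitution (Theorem 2.1 (1))

LABEL: NOT-RH-BEARING addendum (dbl corpus row «W2-La09», G-dbl-26; Lagarias' "toy model"); bears_on
B-C (COLUMN 6 DBR) as context only. WHAT THIS IS NOT: a change of variables between two linear ODEs;
it says nothing about zeros of `ζ` and nothing here bears on the truth of RH.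

Source: J. C. Lagarias, *The Schrödinger operator with Morse potential on the right half-line*,
Commun. Number Theory Phys. **3** (2009) 323–361, arXiv:0712.3238, §2 (read first-hand, arXiv text
pp. 6–10, 18).

## What is typed here (AS PRINTED, with its proof)

**Theorem 2.1 (1)**: "The two-dimensional complex vector space `𝓔_E(V_k(u))` of solutions `φ(u)` [of
`(−d²/du² + V_k(u)) ψ(u) = E ψ(u)`, `V_k(u) = ¼e^{2u} + k e^u`, on a half-line] is given by
`φ(u) = e^{−u/2} f(e^u)` in which `f(x)` is any solution to Whittaker's differential equation
`(d²/dx² + (−1/4 + κ/x + (1/4 − μ²)/x²)) f(x) = 0`, with parameters `κ = −k` and `μ² = −E`."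
Printed proof (arXiv p. 6): "One calculates by direct substitution that if `f(z)` is any solution to
Whittaker's equation, then `φ(u) := e^{−u/2} f(e^u)` satisfies the Schrödinger equation
`(−d²/du² + V_{−κ}(u)) φ(u) = −μ² φ(u)`."

Formalised on OPEN half-lines (`u > u₀`, `x > e^{u₀}`; pointwise twice-differentiable solutions,
`E ∈ ℂ`, `k ∈ ℝ`): `isMorseSolutionOn_whittakerSubst` (Whittaker solution ⇒ Morse solution, the
printed computation), `isWhittakerSolutionOn_whittakerSubstInv` (the converse substitution
`f(x) = √x · φ(log x)`), and the two round-trip identities `whittakerSubst_whittakerSubstInv`,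
`whittakerSubstInv_whittakerSubst` — together: the substitution `φ(u) = e^{−u/2} f(e^u)` is a bijection between the two
solution spaces, which is the content of part (1). (The dimension count "two-dimensional" is the
standard ODE fact and is not restated.)

## What is NOT typed (sized XL for the present tree; listed per the row's "type only with the discharge" rule)

* Theorem 2.1 (2)–(3) (the `L²` solution `e^{−u/2} W_{−k,iz}(e^u)`, limit-point type at `+∞`,
  self-adjointness under `(cos α)ψ(u₀) + (sin α)ψ'(u₀) = 0`, pure discrete simple spectrum bounded
  below, `E₀ > 0` / `E₀ > −k²`): needs the Whittaker function `W_{κ,μ}` with its decay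
  normalisation and Weyl–Titchmarsh theory of half-line Sturm–Liouville operators — absent.
* Theorem 2.2 (monotonicity of the `n`-th eigenvalue in `u₀` and `k`, via min–max): absent min–max
  for such operators.
* Theorem 3.1 (Titchmarsh's eigenvalue-counting law `N(T) = (1/π)∫√(T − V) + O(1)`), Theorem 3.2
  (its Morse case `N(T) = (1/π)√T log √T + (1/π)(2 log 2 − 1 − u₀)√T + O(1)`): absent.
* Theorem 4.1 (`Z(μ) = W_{κ,μ}(e^{u₀})` entire of order 1, zeros on the axes, simple, counting law)
  and Theorem 8.1 (the Weyl–Titchmarsh `m`-function `−W'_{−k,iz}(e^{u₀})/W_{−k,iz}(e^{u₀}) + …`):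
  Whittaker-function theory — absent.

## References

* [Lagarias2009] J. C. Lagarias, *The Schrödinger operator with Morse potential on the right
  half-line*, Commun. Number Theory Phys. 3 (2009), no. 2, 323–361; arXiv:0712.3238. §2, Theorem 2.1.
-/

noncomputable section

open Real Filter Topology Set

namespace Literature.Analysis.DeBrangesSpaces

namespace Lagarias2009

/-- The **Morse potential** `V_k(u) = ¼ e^{2u} + k e^u` (`k` real). [cite: Lagarias2009, §2, display before Theorem 2.1] -/
def morsePotential (k u : ℝ) : ℝ := 1 / 4 * Real.exp (2 * u) + k * Real.exp u

/-- `f` solves **Whittaker's equation** `f'' + (−1/4 + κ/x + (1/4 − μ²)/x²) f = 0` on the open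
half-line `x > x₀`: `f` and `f'` are differentiable there and the equation holds pointwise.
[cite: Lagarias2009, §2, Theorem 2.1 (1), Whittaker's differential equation] -/
def IsWhittakerSolutionOn (κ : ℝ) (μsq : ℂ) (x₀ : ℝ) (f : ℝ → ℂ) : Prop :=
  (∀ x : ℝ, x₀ < x → DifferentiableAt ℝ f x) ∧ (∀ x : ℝ, x₀ < x → DifferentiableAt ℝ (deriv f) x) ∧
    ∀ x : ℝ, x₀ < x →
      deriv (deriv f) x + ((-1 / 4 : ℂ) + (κ : ℂ) / (x : ℂ) + (1 / 4 - μsq) / (x : ℂ) ^ 2) * f x = 0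

/-- `φ` solves the **Schrödinger equation with Morse potential** `−φ'' + V_k(u) φ = E φ` on the open
half-line `u > u₀`: `φ` and `φ'` are differentiable there and the equation holds pointwise.
[cite: Lagarias2009, §2, Theorem 2.1, the Schrödinger equation with potential V_k] -/
def IsMorseSolutionOn (k : ℝ) (E : ℂ) (u₀ : ℝ) (φ : ℝ → ℂ) : Prop :=
  (∀ u : ℝ, u₀ < u → DifferentiableAt ℝ φ u) ∧ (∀ u : ℝ, u₀ < u → DifferentiableAt ℝ (deriv φ) u) ∧
    ∀ u : ℝ, u₀ < u → -deriv (deriv φ) u + (morsePotential k u : ℂ) * φ u = E * φ u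

/-- The Whittaker substitution `φ(u) = e^{−u/2} f(e^u)`. [cite: Lagarias2009, §2, Theorem 2.1 (1)] -/
def whittakerSubst (f : ℝ → ℂ) (u : ℝ) : ℂ := (Real.exp (-u / 2) : ℂ) * f (Real.exp u)

/-! ## Derivatives of the substitution -/

/-- Chain rule for `u ↦ f(e^u)`. [folklore] -/
private theorem hasDerivAt_comp_exp {f : ℝ → ℂ} {f' : ℂ} {u : ℝ}
    (hf : HasDerivAt f f' (Real.exp u)) :
    HasDerivAt (fun v ↦ f (Real.exp v)) ((Real.exp u : ℂ) * f') u := by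
  have h := HasDerivAt.scomp u hf (Real.hasDerivAt_exp u)
  rw [Complex.real_smul] at h
  exact h

/-- Derivative of `u ↦ (e^{−u/2} : ℂ)`. [folklore] -/
private theorem hasDerivAt_exp_neg_half (u : ℝ) :
    HasDerivAt (fun v : ℝ ↦ (Real.exp (-v / 2) : ℂ)) ((-1 / 2 * Real.exp (-u / 2) : ℝ) : ℂ) u := by
  have h1 : HasDerivAt (fun v : ℝ ↦ -v / 2) (-1 / 2) u := by
    have := (hasDerivAt_id u).neg.div_const 2
    simpa using this
  have h2 : HasDerivAt (fun v : ℝ ↦ Real.exp (-v / 2)) (Real.exp (-u / 2) * (-1 / 2)) u :=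
    (Real.hasDerivAt_exp _).comp u h1
  have h3 := h2.ofReal_comp
  refine h3.congr_deriv ?_
  push_cast; ring

/-- First derivative of the substitution: `φ'(u) = e^{−u/2}(−½ f(e^u) + e^u f'(e^u))`. [folklore] -/
private theorem hasDerivAt_subst {f : ℝ → ℂ} {f' : ℂ} {u : ℝ} (hf : HasDerivAt f f' (Real.exp u)) :
    HasDerivAt (whittakerSubst f)
      ((Real.exp (-u / 2) : ℂ) * (-1 / 2 * f (Real.exp u) + (Real.exp u : ℂ) * f')) u := by
  have h := (hasDerivAt_exp_neg_half u).mul (hasDerivAt_comp_exp hf)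
  refine h.congr_deriv ?_
  push_cast; ring


/-! ## Theorem 2.1 (1): Whittaker solutions give Morse–Schrödinger solutions -/

/-- **Lagarias 2009, Theorem 2.1 (1), direct substitution** (printed proof, arXiv p. 6: "one
calculates by direct substitution that if `f(z)` is any solution to Whittaker's equation, then
`φ(u) := e^{−u/2} f(e^u)` satisfies the Schrödinger equation `(−d²/du² + V_{−κ}(u)) φ = −μ² φ`"):
if `f` solves Whittaker's equation with parameters `κ = −k`, `μ² = −E` on `x > e^{u₀}`, then
`φ(u) = e^{−u/2} f(e^u)` solves `−φ'' + V_k(u) φ = E φ` on `u > u₀`.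
[cite: Lagarias2009, §2, Theorem 2.1 (1) and its proof] -/
theorem isMorseSolutionOn_whittakerSubst {k : ℝ} {E : ℂ} {u₀ : ℝ} {f : ℝ → ℂ}
    (hf : IsWhittakerSolutionOn (-k) (-E) (Real.exp u₀) f) :
    IsMorseSolutionOn k E u₀ (whittakerSubst f) := by
  obtain ⟨hd1, hd2, hW⟩ := hf
  have hexp : ∀ u : ℝ, u₀ < u → Real.exp u₀ < Real.exp u := fun u hu ↦ Real.exp_lt_exp.2 hu
  -- first derivative on `u > u₀`
  have hφ1 : ∀ u : ℝ, u₀ < u → HasDerivAt (whittakerSubst f)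
      ((Real.exp (-u / 2) : ℂ) * (-1 / 2 * f (Real.exp u) +
        (Real.exp u : ℂ) * deriv f (Real.exp u))) u :=
    fun u hu ↦ hasDerivAt_subst (hd1 _ (hexp u hu)).hasDerivAt
  have hderiv : ∀ u : ℝ, u₀ < u → deriv (whittakerSubst f) u =
      (Real.exp (-u / 2) : ℂ) * (-1 / 2 * f (Real.exp u) + (Real.exp u : ℂ) * deriv f (Real.exp u)) :=
    fun u hu ↦ (hφ1 u hu).deriv
  -- derivative of the bracket
  have hG : ∀ u : ℝ, u₀ < u →
      HasDerivAt (fun v : ℝ ↦ -1 / 2 * f (Real.exp v) + (Real.exp v : ℂ) * deriv f (Real.exp v))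
        (-1 / 2 * ((Real.exp u : ℂ) * deriv f (Real.exp u)) +
          (((Real.exp u : ℝ) : ℂ) * deriv f (Real.exp u) +
            (Real.exp u : ℂ) * ((Real.exp u : ℂ) * deriv (deriv f) (Real.exp u)))) u := by
    intro u hu
    have h1 : HasDerivAt (fun v : ℝ ↦ f (Real.exp v)) ((Real.exp u : ℂ) * deriv f (Real.exp u)) u :=
      hasDerivAt_comp_exp (hd1 _ (hexp u hu)).hasDerivAt
    have h2 : HasDerivAt (fun v : ℝ ↦ deriv f (Real.exp v))
        ((Real.exp u : ℂ) * deriv (deriv f) (Real.exp u)) u :=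
      hasDerivAt_comp_exp (hd2 _ (hexp u hu)).hasDerivAt
    have h3 : HasDerivAt (fun v : ℝ ↦ (Real.exp v : ℂ)) ((Real.exp u : ℝ) : ℂ) u :=
      (Real.hasDerivAt_exp u).ofReal_comp
    exact (h1.const_mul (-1 / 2 : ℂ)).add (h3.mul h2)
  -- second derivative on `u > u₀`
  have hφ2 : ∀ u : ℝ, u₀ < u → HasDerivAt (deriv (whittakerSubst f))
      ((Real.exp (-u / 2) : ℂ) * (1 / 4 * f (Real.exp u) +
        (Real.exp u : ℂ) ^ 2 * deriv (deriv f) (Real.exp u))) u := by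
    intro u hu
    have h := (hasDerivAt_exp_neg_half u).mul (hG u hu)
    have heq : deriv (whittakerSubst f) =ᶠ[𝓝 u] fun v ↦ (Real.exp (-v / 2) : ℂ) *
        (-1 / 2 * f (Real.exp v) + (Real.exp v : ℂ) * deriv f (Real.exp v)) := by
      filter_upwards [Ioi_mem_nhds hu] with v hv using hderiv v hv
    refine (h.congr_of_eventuallyEq heq).congr_deriv ?_
    push_cast; ring
  refine ⟨fun u hu ↦ (hφ1 u hu).differentiableAt, fun u hu ↦ (hφ2 u hu).differentiableAt,
    fun u hu ↦ ?_⟩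
  rw [(hφ2 u hu).deriv]
  have hx0 : (Real.exp u : ℂ) ≠ 0 := by exact_mod_cast (Real.exp_pos u).ne'
  have hf₂ : deriv (deriv f) (Real.exp u) =
      -((-1 / 4 : ℂ) + ((-k : ℝ) : ℂ) / (Real.exp u : ℂ) + (1 / 4 - -E) / (Real.exp u : ℂ) ^ 2) *
        f (Real.exp u) := by
    linear_combination hW _ (hexp u hu)
  have he2 : Real.exp (2 * u) = Real.exp u ^ 2 := by rw [sq, ← Real.exp_add]; ring_nf
  unfold whittakerSubst morsePotential
  rw [hf₂, he2]
  push_cast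
  field_simp
  ring


/-! ## The inverse substitution `f(x) = √x · φ(log x)` -/

/-- The inverse substitution `f(x) = x^{1/2} φ(log x)` (`x > 0`; written with `e^{(log x)/2} = √x`).
[cite: Lagarias2009, §2, Theorem 2.1 (1)] -/
def whittakerSubstInv (φ : ℝ → ℂ) (x : ℝ) : ℂ := (Real.exp (Real.log x / 2) : ℂ) * φ (Real.log x)

/-- Round trip `φ ↦ f ↦ φ`: `e^{−u/2} · (e^{u/2} φ(u)) = φ(u)` — every `φ` is of the form
`e^{−u/2} f(e^u)`. [cite: Lagarias2009, §2, Theorem 2.1 (1)] -/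
theorem whittakerSubst_whittakerSubstInv (φ : ℝ → ℂ) (u : ℝ) :
    whittakerSubst (whittakerSubstInv φ) u = φ u := by
  unfold whittakerSubst whittakerSubstInv
  rw [Real.log_exp, ← mul_assoc, ← Complex.ofReal_mul, ← Real.exp_add,
    show -u / 2 + u / 2 = 0 by ring, Real.exp_zero, Complex.ofReal_one, one_mul]

/-- Round trip `f ↦ φ ↦ f` on `x > 0`: `√x · e^{−(log x)/2} f(e^{log x}) = f(x)` — the substitution is
injective on Whittaker solutions. [cite: Lagarias2009, §2, Theorem 2.1 (1)] -/
theorem whittakerSubstInv_whittakerSubst (f : ℝ → ℂ) {x : ℝ} (hx : 0 < x) :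
    whittakerSubstInv (whittakerSubst f) x = f x := by
  unfold whittakerSubst whittakerSubstInv
  beta_reduce
  rw [Real.exp_log hx, ← mul_assoc, ← Complex.ofReal_mul, ← Real.exp_add,
    show Real.log x / 2 + -Real.log x / 2 = 0 by ring, Real.exp_zero, Complex.ofReal_one, one_mul]

/-- Chain rule for `x ↦ φ(log x)` at `x ≠ 0`. [folklore] -/
private theorem hasDerivAt_comp_log {φ : ℝ → ℂ} {φ' : ℂ} {x : ℝ} (hx : x ≠ 0)
    (hφ : HasDerivAt φ φ' (Real.log x)) :
    HasDerivAt (fun y ↦ φ (Real.log y)) (((x⁻¹ : ℝ) : ℂ) * φ') x := by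
  have h := HasDerivAt.scomp x hφ (Real.hasDerivAt_log hx)
  rw [Complex.real_smul] at h
  exact h

/-- Derivative of `x ↦ (e^{(log x)/2} : ℂ)` at `x ≠ 0`. [folklore] -/
private theorem hasDerivAt_exp_log_half {x : ℝ} (hx : x ≠ 0) :
    HasDerivAt (fun y : ℝ ↦ (Real.exp (Real.log y / 2) : ℂ))
      ((Real.exp (Real.log x / 2) * (x⁻¹ / 2) : ℝ) : ℂ) x := by
  have h1 : HasDerivAt (fun y : ℝ ↦ Real.log y / 2) (x⁻¹ / 2) x :=
    (Real.hasDerivAt_log hx).div_const 2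
  have h2 : HasDerivAt (fun y : ℝ ↦ Real.exp (Real.log y / 2))
      (Real.exp (Real.log x / 2) * (x⁻¹ / 2)) x := (Real.hasDerivAt_exp _).comp x h1
  exact h2.ofReal_comp

/-- First derivative of the inverse substitution:
`f'(x) = e^{(log x)/2} · (x⁻¹/2 · φ(log x) + x⁻¹ φ'(log x))`. [folklore] -/
private theorem hasDerivAt_substInv {φ : ℝ → ℂ} {φ' : ℂ} {x : ℝ} (hx : x ≠ 0)
    (hφ : HasDerivAt φ φ' (Real.log x)) :
    HasDerivAt (whittakerSubstInv φ)
      ((Real.exp (Real.log x / 2) : ℂ) * (((x⁻¹ / 2 : ℝ) : ℂ) * φ (Real.log x) +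
        ((x⁻¹ : ℝ) : ℂ) * φ')) x := by
  have h := (hasDerivAt_exp_log_half hx).mul (hasDerivAt_comp_log hx hφ)
  refine h.congr_deriv ?_
  push_cast; ring

/-- **Lagarias 2009, Theorem 2.1 (1), converse substitution**: if `φ` solves
`−φ'' + V_k(u) φ = E φ` on `u > u₀`, then `f(x) = x^{1/2} φ(log x)` solves Whittaker's equation
with `κ = −k`, `μ² = −E` on `x > e^{u₀}` (and `φ(u) = e^{−u/2} f(e^u)` by
`whittakerSubst_whittakerSubstInv`), so that the solution space of the Morse equation is exactly
the image of the Whittaker solution space under the substitution `φ(u) = e^{−u/2} f(e^u)`.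
[cite: Lagarias2009, §2, Theorem 2.1 (1)] -/
theorem isWhittakerSolutionOn_whittakerSubstInv {k : ℝ} {E : ℂ} {u₀ : ℝ} {φ : ℝ → ℂ}
    (hφ : IsMorseSolutionOn k E u₀ φ) :
    IsWhittakerSolutionOn (-k) (-E) (Real.exp u₀) (whittakerSubstInv φ) := by
  obtain ⟨hd1, hd2, hM⟩ := hφ
  have hlog : ∀ x : ℝ, Real.exp u₀ < x → u₀ < Real.log x := fun x hx ↦ by
    have := Real.log_lt_log (Real.exp_pos u₀) hx
    rwa [Real.log_exp] at this
  have hpos : ∀ x : ℝ, Real.exp u₀ < x → 0 < x := fun x hx ↦ (Real.exp_pos u₀).trans hx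
  -- first derivative on `x > e^{u₀}`
  have hf1 : ∀ x : ℝ, Real.exp u₀ < x → HasDerivAt (whittakerSubstInv φ)
      ((Real.exp (Real.log x / 2) : ℂ) * (((x⁻¹ / 2 : ℝ) : ℂ) * φ (Real.log x) +
        ((x⁻¹ : ℝ) : ℂ) * deriv φ (Real.log x))) x :=
    fun x hx ↦ hasDerivAt_substInv (hpos x hx).ne' (hd1 _ (hlog x hx)).hasDerivAt
  have hderiv : ∀ x : ℝ, Real.exp u₀ < x → deriv (whittakerSubstInv φ) x =
      (Real.exp (Real.log x / 2) : ℂ) * (((x⁻¹ / 2 : ℝ) : ℂ) * φ (Real.log x) +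
        ((x⁻¹ : ℝ) : ℂ) * deriv φ (Real.log x)) := fun x hx ↦ (hf1 x hx).deriv
  -- derivative of the bracket
  have hB : ∀ x : ℝ, Real.exp u₀ < x →
      HasDerivAt (fun y : ℝ ↦ ((y⁻¹ / 2 : ℝ) : ℂ) * φ (Real.log y) + ((y⁻¹ : ℝ) : ℂ) * deriv φ (Real.log y))
        ((((-(x ^ 2)⁻¹ / 2 : ℝ)) : ℂ) * φ (Real.log x) +
            ((x⁻¹ / 2 : ℝ) : ℂ) * (((x⁻¹ : ℝ) : ℂ) * deriv φ (Real.log x)) +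
          ((((-(x ^ 2)⁻¹ : ℝ)) : ℂ) * deriv φ (Real.log x) +
            ((x⁻¹ : ℝ) : ℂ) * (((x⁻¹ : ℝ) : ℂ) * deriv (deriv φ) (Real.log x)))) x := by
    intro x hx
    have hx0 : x ≠ 0 := (hpos x hx).ne'
    have h1 : HasDerivAt (fun y : ℝ ↦ φ (Real.log y)) (((x⁻¹ : ℝ) : ℂ) * deriv φ (Real.log x)) x :=
      hasDerivAt_comp_log hx0 (hd1 _ (hlog x hx)).hasDerivAt
    have h2 : HasDerivAt (fun y : ℝ ↦ deriv φ (Real.log y))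
        (((x⁻¹ : ℝ) : ℂ) * deriv (deriv φ) (Real.log x)) x :=
      hasDerivAt_comp_log hx0 (hd2 _ (hlog x hx)).hasDerivAt
    have h3 : HasDerivAt (fun y : ℝ ↦ ((y⁻¹ / 2 : ℝ) : ℂ)) (((-(x ^ 2)⁻¹ / 2 : ℝ)) : ℂ) x :=
      ((hasDerivAt_inv hx0).div_const 2).ofReal_comp
    have h4 : HasDerivAt (fun y : ℝ ↦ ((y⁻¹ : ℝ) : ℂ)) (((-(x ^ 2)⁻¹ : ℝ)) : ℂ) x :=
      (hasDerivAt_inv hx0).ofReal_comp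
    exact (h3.mul h1).add (h4.mul h2)
  -- second derivative
  have hf2 : ∀ x : ℝ, Real.exp u₀ < x → HasDerivAt (deriv (whittakerSubstInv φ))
      ((Real.exp (Real.log x / 2) : ℂ) * (((x⁻¹ : ℝ) : ℂ) ^ 2 *
        (deriv (deriv φ) (Real.log x) - 1 / 4 * φ (Real.log x)))) x := by
    intro x hx
    have hx0 : x ≠ 0 := (hpos x hx).ne'
    have h := (hasDerivAt_exp_log_half hx0).mul (hB x hx)
    have heq : deriv (whittakerSubstInv φ) =ᶠ[𝓝 x] fun y ↦ (Real.exp (Real.log y / 2) : ℂ) *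
        (((y⁻¹ / 2 : ℝ) : ℂ) * φ (Real.log y) + ((y⁻¹ : ℝ) : ℂ) * deriv φ (Real.log y)) := by
      filter_upwards [Ioi_mem_nhds hx] with y hy using hderiv y hy
    refine (h.congr_of_eventuallyEq heq).congr_deriv ?_
    have hx0' : (x : ℂ) ≠ 0 := by exact_mod_cast hx0
    push_cast
    field_simp
    ring
  refine ⟨fun x hx ↦ (hf1 x hx).differentiableAt, fun x hx ↦ (hf2 x hx).differentiableAt,
    fun x hx ↦ ?_⟩
  rw [(hf2 x hx).deriv]
  have hx0 : x ≠ 0 := (hpos x hx).ne'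
  have hx0' : (x : ℂ) ≠ 0 := by exact_mod_cast hx0
  have hφ₂ : deriv (deriv φ) (Real.log x) =
      (morsePotential k (Real.log x) : ℂ) * φ (Real.log x) - E * φ (Real.log x) := by
    linear_combination -(hM _ (hlog x hx))
  have hV : morsePotential k (Real.log x) = 1 / 4 * x ^ 2 + k * x := by
    unfold morsePotential
    rw [show 2 * Real.log x = Real.log x + Real.log x by ring, Real.exp_add, Real.exp_log (hpos x hx)]
    ring
  unfold whittakerSubstInv
  rw [hφ₂, hV]
  push_cast
  field_simp
  ring

end Lagarias2009

end Literature.Analysis.DeBrangesSpaces
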